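import Literature.NumberTheory.LFunctions.MatomakiRadziwillTaoSiftedDistance
import Literature.NumberTheory.LFunctions.HalaszRestrictedWindow
import Literature.NumberTheory.Sieve.MatomakiRadziwillLemma4Lipschitz
import HarnessLib

/-!
# Sifted distances relative to the minimiser: the lower bound as a function of its inputs, and twists

Topic `Literature/NumberTheory/LFunctions`.  Everything in this file is PROVED; no definitions, no named facts.

`MatomakiRadziwillTaoSiftedDistance.lean` proves, from Ford's bound, that every sifted copy `f'` of a `1`-bounded
`f` (`f'(p) ∈ {f(p), 0}`) has `𝔻(f', n^{is}; x)² ≥ ((√2−1)/6) log log x − C` for `|s − t₁| ≥ 2`, `t₁` a near-minimiser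
of `u ↦ 𝔻(f, n^{iu}; x)²`.  For Lemma A.4 of Matomäki–Radziwiłł–Tao 2015 on the fibres of Matomäki–Radziwiłł's
Lemma 3 the same device is needed at heights `Y ≥ X^{1/32}` with the minimiser `t₁` taken at the top height `X`
(so only an `O(1)`-near-minimiser at height `Y`), with twists `|s| ≤ 2X ≫ Y`, and with the Vinogradov–Korobov input in
the form available from Khale's region (`TwistedPrimeSumTail`).  This file therefore records the device with its two
inputs as hypotheses, and the bookkeeping around it:

* `MRT2015.pretentiousDistSq_sifted_ge_of_lowerBound` — if `𝔻(f, n^{it₁}; x)² ≤ 𝔻(f, n^{is}; x)² + δ` and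
  `B ≤ 𝔻(1, n^{i(s−t₁)}; x)²` then `((√2−1)/2) B − δ/2 ≤ 𝔻(f', n^{is}; x)²` (the proof of
  `pretentiousDistSq_sifted_ge_of_ford` verbatim with `(δ, B)` for `(1, (1/3) log log x − C)`);
* `MRT2015.pretentiousDistSq_twistAF` — `Msum (twistAF φ t) Y y = 𝔻(φ, n^{i(t+y)}; Y)²`.

## References
* K. Matomäki, M. Radziwiłł, T. Tao, Algebra & Number Theory 9 (2015), Appendix A, proof of Proposition A.3 and
  Lemma A.4. [cite: MatomakiRadziwillTao2015, Appendix A, Lemma A.4]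
* K. Matomäki, M. Radziwiłł, *Multiplicative functions in short intervals II*, arXiv:2007.04290, Lemma 5.2(ii)
  (the nearest printed statement). [cite: MatomakiRadziwill2020ShortIntervalsII, Lemma 5.2(ii)]
-/

noncomputable section

open Finset Real Complex
open scoped ComplexConjugate

namespace Literature.NumberTheory.LFunctions

namespace MRT2015

open Literature.NumberTheory.Sieve (pretentiousDistSq)

/-- **The Granville–Soundararajan device for sifted copies, with explicit inputs.**  Let `|f| ≤ 1` and `f'` with
`f'(p) ∈ {f(p), 0}` at every prime, and suppose `𝔻(f, n^{it₁}; x)² ≤ 𝔻(f, n^{is}; x)² + δ` (`δ ≥ 0`) and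
`B ≤ 𝔻(1, n^{i(s−t₁)}; x)²`.  Then `((√2 − 1)/2) B − δ/2 ≤ 𝔻(f', n^{is}; x)²`.
[cite: MatomakiRadziwillTao2015, Appendix A, Lemma A.4] -/
theorem pretentiousDistSq_sifted_ge_of_lowerBound {x δ B t₁ s : ℝ} {f f' : ℕ → ℂ}
    (hf : ∀ n, ‖f n‖ ≤ 1) (hmask : ∀ p : ℕ, p.Prime → f' p = f p ∨ f' p = 0)
    (hδ : 0 ≤ δ)
    (hmin : pretentiousDistSq f (fun n : ℕ => (n : ℂ) ^ ((t₁ : ℂ) * I)) x ≤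
      pretentiousDistSq f (fun n : ℕ => (n : ℂ) ^ ((s : ℂ) * I)) x + δ)
    (hB : B ≤ pretentiousDistSq 1 (fun n : ℕ => (n : ℂ) ^ (((s - t₁ : ℝ) : ℂ) * I)) x) :
    (Real.sqrt 2 - 1) / 2 * B - δ / 2 ≤ pretentiousDistSq f' (fun n : ℕ => (n : ℂ) ^ ((s : ℂ) * I)) x := by
  set c : ℝ := (Real.sqrt 2 - 1) / 2 with hc
  -- the twists and the summands
  set τ : ℝ → ℕ → ℂ := fun t n => (n : ℂ) ^ ((t : ℂ) * I) with hτ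
  have hτ1 : ∀ t n, ‖τ t n‖ ≤ 1 := fun t n => norm_natCast_cpow_mul_I_le_one n t
  have h11 : ∀ n, ‖(1 : ℕ → ℂ) n‖ ≤ 1 := fun n => by simp
  set T : (ℕ → ℂ) → (ℕ → ℂ) → ℕ → ℝ := fun a b p => (1 - (a p * conj (b p)).re) / (p : ℝ) with hT
  have hT0 : ∀ a b : ℕ → ℂ, (∀ n, ‖a n‖ ≤ 1) → (∀ n, ‖b n‖ ≤ 1) → ∀ p, 0 ≤ T a b p :=
    fun a b ha hb p => Sieve.pretentiousDistSq_summand_nonneg ha hb p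
  have hT2 : ∀ a b : ℕ → ℂ, (∀ n, ‖a n‖ ≤ 1) → (∀ n, ‖b n‖ ≤ 1) → ∀ p, T a b p ≤ 2 / (p : ℝ) := by
    intro a b ha hb p
    refine div_le_div_of_nonneg_right ?_ (Nat.cast_nonneg p)
    have h1 : |(a p * conj (b p)).re| ≤ ‖a p * conj (b p)‖ := Complex.abs_re_le_norm _
    have h2 : ‖a p * conj (b p)‖ ≤ 1 := by
      rw [norm_mul, Complex.norm_conj]
      calc ‖a p‖ * ‖b p‖ ≤ 1 * 1 := mul_le_mul (ha p) (hb p) (norm_nonneg _) zero_le_one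
        _ = 1 := one_mul 1
    have := (abs_le.1 (h1.trans h2)).1
    linarith
  -- the prime sets: `S` all primes `≤ x`, `Eo` those with `f' = f`, `E` the removed ones
  set S := Nat.primesLE ⌊x⌋₊ with hS
  set Eo := S.filter (fun p => f' p = f p) with hEo
  set E := S.filter (fun p => ¬ f' p = f p) with hE
  set K : ℝ := ∑ p ∈ E, (1 : ℝ) / p with hK
  have hK0 : 0 ≤ K := Finset.sum_nonneg fun p _ => by positivity
  have hsplit : ∀ a b : ℕ → ℂ, pretentiousDistSq a b x = ∑ p ∈ Eo, T a b p + ∑ p ∈ E, T a b p := by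
    intro a b
    rw [Sieve.pretentiousDistSq, ← Finset.sum_filter_add_sum_filter_not S (fun p => f' p = f p)]
  have hEsum0 : ∀ a b : ℕ → ℂ, (∀ n, ‖a n‖ ≤ 1) → (∀ n, ‖b n‖ ≤ 1) → 0 ≤ ∑ p ∈ E, T a b p :=
    fun a b ha hb => Finset.sum_nonneg fun p _ => hT0 a b ha hb p
  have hEsum2 : ∀ a b : ℕ → ℂ, (∀ n, ‖a n‖ ≤ 1) → (∀ n, ‖b n‖ ≤ 1) → ∑ p ∈ E, T a b p ≤ 2 * K := by
    intro a b ha hb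
    calc ∑ p ∈ E, T a b p ≤ ∑ p ∈ E, 2 / (p : ℝ) := Finset.sum_le_sum fun p _ => hT2 a b ha hb p
      _ = 2 * K := by
          rw [hK, Finset.mul_sum]
          exact Finset.sum_congr rfl fun p _ => by ring
  have hmemE : ∀ p ∈ E, p.Prime ∧ f' p = 0 := by
    intro p hp
    rw [hE, Finset.mem_filter, hS, Nat.mem_primesLE] at hp
    rcases hmask p hp.1.2 with h | h
    · exact (hp.2 h).elim
    · exact ⟨hp.1.2, h⟩
  have hmemEo : ∀ p ∈ Eo, p.Prime ∧ f' p = f p := by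
    intro p hp
    rw [hEo, Finset.mem_filter, hS, Nat.mem_primesLE] at hp
    exact ⟨hp.1.2, hp.2⟩
  -- (a) `𝔻(f', n^{is})² = D2 + K`
  set D2 : ℝ := ∑ p ∈ Eo, T f (τ s) p with hD2
  have hD20 : 0 ≤ D2 := Finset.sum_nonneg fun p _ => hT0 f (τ s) hf (hτ1 s) p
  have ha : pretentiousDistSq f' (τ s) x = D2 + K := by
    rw [hsplit, hD2, hK]
    congr 1
    · refine Finset.sum_congr rfl fun p hp => ?_
      simp only [hT, (hmemEo p hp).2]
    · refine Finset.sum_congr rfl fun p hp => ?_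
      simp only [hT, (hmemE p hp).2, zero_mul, Complex.zero_re, sub_zero]
  -- (b) minimality: `A2 ≤ D2 + 2K + δ`
  set A2 : ℝ := ∑ p ∈ Eo, T f (τ t₁) p with hA2
  have hA20 : 0 ≤ A2 := Finset.sum_nonneg fun p _ => hT0 f (τ t₁) hf (hτ1 t₁) p
  have hb : A2 ≤ D2 + 2 * K + δ := by
    have h := hmin
    change pretentiousDistSq f (τ t₁) x ≤ pretentiousDistSq f (τ s) x + δ at h
    rw [hsplit, hsplit f (τ s)] at h
    have h1 := hEsum0 f (τ t₁) hf (hτ1 t₁)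
    have h2 := hEsum2 f (τ s) hf (hτ1 s)
    rw [← hA2, ← hD2] at h
    linarith
  -- (c) the triangle inequality on the unsifted primes: `√b2 ≤ √A2 + √D2`
  set b2 : ℝ := ∑ p ∈ Eo, T (τ t₁) (τ s) p with hb2
  have hb20 : 0 ≤ b2 := Finset.sum_nonneg fun p _ => hT0 (τ t₁) (τ s) (hτ1 t₁) (hτ1 s) p
  have hA2' : ∑ p ∈ Eo, T (τ t₁) f p = A2 := by
    rw [hA2]
    refine Finset.sum_congr rfl fun p _ => ?_
    simp only [hT]
    rw [← Complex.conj_re (τ t₁ p * conj (f p)), map_mul, Complex.conj_conj, mul_comm]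
  have hc' : Real.sqrt b2 ≤ Real.sqrt A2 + Real.sqrt D2 := by
    rw [← hA2', hb2, hD2]
    refine Sieve.sqrt_sum_le_sqrt_sum_add_sqrt_sum Eo (hT0 _ _ (hτ1 t₁) (hτ1 s)) (hT0 _ _ (hτ1 t₁) hf)
      (hT0 _ _ hf (hτ1 s)) fun p _ => ?_
    simp only [hT]
    rw [Real.sqrt_div' _ (Nat.cast_nonneg p), Real.sqrt_div' _ (Nat.cast_nonneg p),
      Real.sqrt_div' _ (Nat.cast_nonneg p), ← add_div]
    exact div_le_div_of_nonneg_right (Sieve.sqrt_one_sub_re_mul_conj_le (hτ1 t₁ p) (hf p) (hτ1 s p))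
      (Real.sqrt_nonneg _)
  -- (d) `b2 ≥ 𝔻(1, n^{i(s−t₁)})² − 2K ≥ B − 2K`
  have hVKu : B ≤ pretentiousDistSq 1 (τ (s - t₁)) x := hB
  have hd : B - 2 * K ≤ b2 := by
    rw [hsplit] at hVKu
    have h2 := hEsum2 1 (τ (s - t₁)) h11 (hτ1 _)
    have heq : ∑ p ∈ Eo, T 1 (τ (s - t₁)) p = b2 := by
      rw [hb2]
      refine Finset.sum_congr rfl fun p hp => ?_
      have hp0 : p ≠ 0 := (hmemEo p hp).1.ne_zero
      simp only [hT, hτ, Pi.one_apply, one_mul]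
      rw [cpow_mul_conj_cpow_eq hp0]
    linarith
  -- (e) the optimisation with `K + δ/2`, `D = √D2`, `b = √b2`, `B + δ`
  have hopt := sifted_distance_optimisation (B := B + δ) (K := K + δ / 2)
    (D := Real.sqrt D2) (b := Real.sqrt b2) (by linarith) (Real.sqrt_nonneg _)
    (by rw [Real.sq_sqrt hb20]; linarith)
    (by
      have e : Real.sqrt D2 ^ 2 + 2 * (K + δ / 2) = D2 + 2 * K + δ := by rw [Real.sq_sqrt hD20]; ring
      rw [e]
      exact hc'.trans (add_le_add (Real.sqrt_le_sqrt hb) le_rfl))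
  rw [Real.sq_sqrt hD20] at hopt
  change pretentiousDistSq f' (τ s) x ≥ _  -- orient
  rw [ha]
  have hc0 : 0 ≤ c := by
    rw [hc]; have : (1:ℝ) ≤ Real.sqrt 2 := by
      rw [show (1:ℝ) = Real.sqrt 1 by simp]; exact Real.sqrt_le_sqrt (by norm_num)
    linarith
  nlinarith [hopt, mul_nonneg hc0 hδ]


/-! ### Twists -/

/-- For `φ : ℕ → ℂ` and the twist `G = twistAF φ t` (`G(n) = φ(n) n^{-it}`):
`Msum G Y y = 𝔻(φ, n^{i(t+y)}; Y)²`. [folklore] -/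
theorem Msum_twistAF (φ : ArithmeticFunction ℂ) (t Y y : ℝ) :
    Sieve.MatomakiRadziwillL4A.Msum (Sieve.MatomakiRadziwillL4A.twistAF φ t) Y y =
      pretentiousDistSq φ (fun n : ℕ => (n : ℂ) ^ (((t + y : ℝ) : ℂ) * I)) Y := by
  rw [Sieve.MatomakiRadziwillL4A.Msum_eq_pretentiousDistSq]
  unfold pretentiousDistSq
  refine Finset.sum_congr rfl fun p hp => ?_
  rw [Nat.mem_primesLE] at hp
  rw [Sieve.MatomakiRadziwillL4A.twistAF_apply]
  have h := Halasz.Restricted.mul_cpow_neg_mul_conj_cpow hp.2.pos (φ p) t y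
  rw [show (-(↑t * I) : ℂ) = -((t : ℂ) * I) by ring] 
  rw [h]

/-- **The distance floor on the fibres of Lemma 3 / Lemma A.4.**  Let `|f| ≤ 1`, `t₁` a `δ₀`-near-minimiser of
`u ↦ 𝔻(f, n^{iu}; X)²` over `|u| ≤ W`, `φ` an arithmetic function with `φ(p) ∈ {f(p), 0}` at primes (a sifted copy),
`Y ≤ X` a lower height, and `B` a lower bound for `𝔻(1, n^{iτ'}; Y)²` on `2 ≤ |τ'| ≤ W_τ`.  If `|t| + 2T_H ≤ W`,
`|t₁| + W ≤ W_τ` and `|t − t₁| ≥ 2T_H + 2`, then for every `|y| ≤ 2T_H` the twist `G = twistAF φ t` has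
`Msum G Y y = 𝔻(φ, n^{i(t+y)}; Y)² ≥ ((√2−1)/2) B − (δ₀ + 2 ∑_{Y < p ≤ X} 1/p)/2` — the hypothesis `hM₀` of
`MatomakiRadziwillL3C.fibre_bound` (the near-minimiser is moved from height `X` to height `Y` at the cost of the prime
tail). [cite: MatomakiRadziwillTao2015, Appendix A, Lemma A.4] -/
theorem Msum_twistAF_sifted_ge {f : ℕ → ℂ} (hf : ∀ n, ‖f n‖ ≤ 1) {φ : ArithmeticFunction ℂ}
    (hmask : ∀ p : ℕ, p.Prime → φ p = f p ∨ φ p = 0) {X Y W Wτ δ₀ B t₁ t TH : ℝ}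
    (hYX : Y ≤ X) (hδ₀ : 0 ≤ δ₀)
    (hmin : ∀ u : ℝ, |u| ≤ W → pretentiousDistSq f (fun n : ℕ => (n : ℂ) ^ ((t₁ : ℂ) * I)) X ≤
      pretentiousDistSq f (fun n : ℕ => (n : ℂ) ^ ((u : ℂ) * I)) X + δ₀)
    (hB : ∀ τ' : ℝ, 2 ≤ |τ'| → |τ'| ≤ Wτ → B ≤ pretentiousDistSq 1 (fun n : ℕ => (n : ℂ) ^ ((τ' : ℂ) * I)) Y)
    (htW : |t| + 2 * TH ≤ W) (ht₁ : |t₁| + W ≤ Wτ) (hfar : 2 * TH + 2 ≤ |t - t₁|) :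
    ∀ y : ℝ, |y| ≤ 2 * TH →
      (Real.sqrt 2 - 1) / 2 * B - (δ₀ + 2 * ∑ p ∈ (Finset.Ioc ⌊Y⌋₊ ⌊X⌋₊).filter Nat.Prime, (1 : ℝ) / p) / 2 ≤
        Sieve.MatomakiRadziwillL4A.Msum (Sieve.MatomakiRadziwillL4A.twistAF φ t) Y y := by
  intro y hy
  rw [Msum_twistAF]
  have hτ : ∀ (s : ℝ) (n : ℕ), ‖(n : ℂ) ^ ((s : ℂ) * I)‖ ≤ 1 := fun s n =>
    Sieve.MatomakiRadziwillL4A.norm_natCast_cpow_mul_I n s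
  have hy' := abs_le.1 hy
  have hsW : |t + y| ≤ W := by
    have := abs_add_le t y; linarith
  -- near-minimality at height `Y`
  set tail : ℝ := ∑ p ∈ (Finset.Ioc ⌊Y⌋₊ ⌊X⌋₊).filter Nat.Prime, (1 : ℝ) / p with htail
  have htail0 : 0 ≤ tail := Finset.sum_nonneg fun p _ => by positivity
  have hmin' : pretentiousDistSq f (fun n : ℕ => (n : ℂ) ^ ((t₁ : ℂ) * I)) Y ≤
      pretentiousDistSq f (fun n : ℕ => (n : ℂ) ^ (((t + y : ℝ) : ℂ) * I)) Y + (δ₀ + 2 * tail) := by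
    have h1 : pretentiousDistSq f (fun n : ℕ => (n : ℂ) ^ ((t₁ : ℂ) * I)) Y ≤
        pretentiousDistSq f (fun n : ℕ => (n : ℂ) ^ ((t₁ : ℂ) * I)) X :=
      Sieve.pretentiousDistSq_mono hf (hτ t₁) hYX
    have h2 := hmin (t + y) hsW
    have h3 := Sieve.HalaszMT.pretentiousDistSq_le_add_tail hf (hτ (t + y)) hYX (g := f)
    rw [htail]
    linarith
  -- the input at `τ' = (t + y) - t₁`
  have hB' : B ≤ pretentiousDistSq 1 (fun n : ℕ => (n : ℂ) ^ ((((t + y) - t₁ : ℝ) : ℂ) * I)) Y := by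
    refine hB ((t + y) - t₁) ?_ ?_
    · have h1 : |t - t₁| ≤ |t + y - t₁| + |y| :=
        calc |t - t₁| = |(t + y - t₁) - y| := by congr 1; ring
          _ ≤ |t + y - t₁| + |y| := abs_sub _ _
      linarith
    · have h1 : |t + y - t₁| ≤ |t + y| + |t₁| := abs_sub _ _
      linarith
  have h := pretentiousDistSq_sifted_ge_of_lowerBound hf hmask (by positivity) hmin' hB'
  linarith

end MRT2015

end Literature.NumberTheory.LFunctions

end
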